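import Summits.MatrixMultiplication.OmegaCensus.SmallFormats.MatMul22nRankGF5Classes
import Summits.MatrixMultiplication.OmegaCensus.SmallFormats.MatMul22nRankFiniteField
import Literature.Computability.AlgebraicComplexity.MatMulTwoThreeNRankBounds
import HarnessLib

/-!
# ω-census family (a): `R_𝔽₅(⟨2,2,n⟩) ≥ 3n + 2` for `n ≥ 6` (Alekseev's any-field value, kernel over `𝔽₅`)

Cell `pub-omega` (unit `pub-omega-tensor-g7`), topic `Summits/MatrixMultiplication/OmegaCensus` (sub-folder
`SmallFormats`). Framing (verbatim): lottery ticket; floor = certified bounds/negative ranges. HONEST FRAMING: the VALUE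
`R(⟨2,2,n⟩) ≥ 3n + 2` (`n ≥ 3`) over every field is PRINTED — Alekseev 2014/2015 (tree: the NAMED FACT
`alekseev2015_rank_matMulTensor_m22_ge` and its corollaries in `MatMulM22RankLowerBound.lean`). New for the census: an
UNCONDITIONAL kernel proof over `𝔽₅` for every `n ≥ 6` (for `n ≥ 10` the tree's counting theorem `27·R ≥ 84·n`,
`MatMul22nRankFiniteField.lean`, already gives it; the cells gained are `n = 6, 7, 8, 9`), by the route of
`MatMul22nRankGF3ThreeNPlusTwo.lean` (`𝔽₃`) with one new ingredient: TWO sandwich normalisations of the X-forms before a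
`decide`-sized clique certificate. Nothing here is progress on `ω`.

THE ARGUMENT. Let `⟨2,2,n⟩ = ∑_{t<r} w_t ⊗ u_t ⊗ v_t` over `𝔽₅` with `r ≤ 3n + 1`, and let `z / a / b` count the zero /
rank-one / invertible X-matrices `u_t`.
* Every dual-type plane and every `𝔽₂₅`-type plane `D` of `M₂(𝔽₅)` has `3n + #{t : u_t ⊥ D} ≤ r` (the module / quadratic-plane
  caps `JPlane.three_mul_add_card_le`, `QPlane.three_mul_add_card_le`), so each is annihilated by AT MOST ONE `u_t`
  (`pair_false_gf5`).
* Hence the invertible `u_t` lie in pairwise *uncapped* classes (no common dual/`𝔽₂₅` plane; for classes `A ≠ B` this says that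
  `A⁻¹B` has two distinct eigenvalues in `𝔽₅`). The graph "uncapped" on the 120 invertible classes of `M₂(𝔽₅)` has clique
  number `5` (`no_six_gf5`): given six such forms, transport the computation along `x ↦ A₀⁻ᵀ x` (`xSandwich`; the caps are
  invariant) so that the first form is `I`; the second is then capped with `I` (table `wI5`) or conjugate — by a second sandwich
  `x ↦ P x P⁻¹` fixing `I` (table `cjP5`) — to a multiple of `D_β = diag(1, β+2)`; each remaining form is capped with `I` or with
  `D_β` (tables `wI5`, `wD5`) or lies in the list `nb5 β` (≤ 20 classes), and among any four listed classes two are capped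
  (`four5_ok`). So `b ≤ 5`.
* lit's quantitative rank-one-plane cap (`card_vanishing_le_two_mul_sub`): each of the 6 row planes `{x : λᵀx = 0}` carries at
  most `2r − 6n ≤ 2` of the `u_t`; a zero `u` lies on all six, a rank-one `u` on at least one: `6z + a ≤ 12`.
* So `r = z + a + b ≤ 17`, whereas `r ≥ 3n + 1 ≥ 19` (Lafon–Winograd, tree) for `n ≥ 6`: contradiction. Hence `R ≥ 3n + 2`.
-/

namespace Summit.MatrixMultiplication.OmegaCensus.SmallFormats

open Module Matrix Literature.Computability.AlgebraicComplexity
open Summit.MatrixMultiplication.OmegaCensus.RankOnePlaneCapGeneral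

/-! ## Sandwich transport of the X-forms (any field) -/

section Sandwich

variable {k : Type*} [Field k]

/-- `⟨A, P x Q⟩ = ⟨Pᵀ A Qᵀ, x⟩`: the X-coefficients after a sandwich. -/
theorem dotX_sand (P Q : Matrix (Fin 2) (Fin 2) k) (A : Fin 2 × Fin 2 → k) (x : Matrix (Fin 2) (Fin 2) k) :
    dotX A (P * x * Q) = dotX (sand P Q A) x := by
  simp only [dotX_eq, sand, Matrix.mul_apply, Fin.sum_univ_two]
  ring

/-- `sand` is linear in the coefficient function: multiples go to multiples. -/
theorem sand_smul {P Q : Matrix (Fin 2) (Fin 2) k} {A R : Fin 2 × Fin 2 → k} {s : k} (h : ∀ p, A p = s * R p)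
    (p : Fin 2 × Fin 2) : sand P Q A p = s * sand P Q R p := by
  simp only [sand, h]; ring

/-- `sand` respects pointwise equality of coefficient functions. -/
theorem sand_congr {P Q : Matrix (Fin 2) (Fin 2) k} {A R : Fin 2 × Fin 2 → k} (h : ∀ p, A p = R p)
    (p : Fin 2 × Fin 2) : sand P Q A p = sand P Q R p := by
  simp only [sand, h]

/-- The `2×2` determinant of a matrix, written out. -/
def mdet2 (P : Matrix (Fin 2) (Fin 2) k) : k := P 0 0 * P 1 1 - P 0 1 * P 1 0

/-- `det (Pᵀ A Qᵀ) = det P · det A · det Q`. -/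
theorem det2_sand (P Q : Matrix (Fin 2) (Fin 2) k) (A : Fin 2 × Fin 2 → k) :
    det2 (sand P Q A) = mdet2 P * det2 A * mdet2 Q := by
  simp only [det2, mdet2, sand]; ring

/-- Multiplicativity of `mdet2`. -/
theorem mdet2_mul (P Q : Matrix (Fin 2) (Fin 2) k) : mdet2 (P * Q) = mdet2 P * mdet2 Q := by
  simp only [mdet2, Matrix.mul_apply, Fin.sum_univ_two]; ring

/-- `mdet2 1 = 1`. -/
theorem mdet2_one : mdet2 (1 : Matrix (Fin 2) (Fin 2) k) = 1 := by
  simp [mdet2]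

/-- A left factor of `1` has nonzero determinant. -/
theorem mdet2_ne_zero_left {P Q : Matrix (Fin 2) (Fin 2) k} (h : P * Q = 1) : mdet2 P ≠ 0 := by
  intro h0
  have e := congrArg mdet2 h
  rw [mdet2_mul, mdet2_one, h0, zero_mul] at e
  exact zero_ne_one e

/-- A right factor of `1` has nonzero determinant. -/
theorem mdet2_ne_zero_right {P Q : Matrix (Fin 2) (Fin 2) k} (h : P * Q = 1) : mdet2 Q ≠ 0 := by
  intro h0
  have e := congrArg mdet2 h
  rw [mdet2_mul, mdet2_one, h0, mul_zero] at e
  exact zero_ne_one e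

/-- A multiple of `R` has `det = s²·det R`. -/
theorem det2_of_eq_mul {A R : Fin 2 × Fin 2 → k} {s : k} (h : ∀ p, A p = s * R p) : det2 A = s * s * det2 R := by
  simp only [det2, h]; ring

/-- `(A⁻¹)ᵀ` for an invertible coefficient function `A` (as a matrix): the first normalisation `x ↦ (A⁻¹)ᵀ x`. -/
noncomputable def P1 (A : Fin 2 × Fin 2 → k) : Matrix (Fin 2) (Fin 2) k :=
  !![(det2 A)⁻¹ * A (1, 1), -((det2 A)⁻¹ * A (1, 0)); -((det2 A)⁻¹ * A (0, 1)), (det2 A)⁻¹ * A (0, 0)]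

/-- `Aᵀ`, the inverse of `P1 A`. -/
def P1' (A : Fin 2 × Fin 2 → k) : Matrix (Fin 2) (Fin 2) k := !![A (0, 0), A (1, 0); A (0, 1), A (1, 1)]

/-- `Aᵀ (A⁻¹)ᵀ = 1`. -/
theorem P1'_mul_P1 (A : Fin 2 × Fin 2 → k) (h : det2 A ≠ 0) : P1' A * P1 A = 1 := by
  have h' : A (0, 0) * A (1, 1) - A (0, 1) * A (1, 0) ≠ 0 := h
  ext i j
  fin_cases i <;> fin_cases j <;>
    · simp [P1, P1', Matrix.mul_apply, Fin.sum_univ_two, det2]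
      field_simp
      ring

/-- The first normalisation takes the form `A` to the identity form: `(A⁻¹)ᵀᵀ A 1ᵀ = I`. -/
theorem sand_P1 (A : Fin 2 × Fin 2 → k) (h : det2 A ≠ 0) : ∀ p, sand (P1 A) 1 A p = mk4 (1 : k) 0 0 1 p := by
  have h' : A (0, 0) * A (1, 1) - A (0, 1) * A (1, 0) ≠ 0 := h
  rintro ⟨a, b⟩
  fin_cases a <;> fin_cases b <;>
    · simp [sand, P1, mk4, Matrix.one_fin_two, det2]
      field_simp
      ring

/-- `det (A⁻¹)ᵀ ≠ 0`. -/
theorem mdet2_P1_ne_zero (A : Fin 2 × Fin 2 → k) (h : det2 A ≠ 0) : mdet2 (P1 A) ≠ 0 :=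
  mdet2_ne_zero_right (P1'_mul_P1 A h)

variable {n : ℕ} {ι : Type*} [Fintype ι]

/-- **Sandwich transport of a computation of `⟨2,2,n⟩`** along `x ↦ P x Q`, `y ↦ Q' y`, `z ↦ P' z`
(`P'P = 1`, `QQ' = 1`): `x y = P' ((P x Q)(Q' y))`. -/
noncomputable def xSandwich (β : BilinComp (mulBilin k 2 2 n) ι) (P P' Q Q' : Matrix (Fin 2) (Fin 2) k)
    (hP : P' * P = 1) (hQ : Q * Q' = 1) : BilinComp (mulBilin k 2 2 n) ι :=
  β.comap ((mulLeftLin k P).comp (mulRightLin k Q)) (mulLeftLin k Q') (mulLeftLin k P') (fun x y => by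
    simp only [mulBilin_apply, mulLeftLin_apply, mulRightLin_apply, LinearMap.comp_apply]
    calc x * y = (P' * P) * x * (Q * Q') * y := by rw [hP, hQ, Matrix.one_mul, Matrix.mul_one]
      _ = P' * (P * (x * Q) * (Q' * y)) := by simp only [Matrix.mul_assoc])

/-- The X-forms of the transported computation are `x ↦ ⟨Pᵀ A_i Qᵀ, x⟩`. -/
theorem xSandwich_dotX (β : BilinComp (mulBilin k 2 2 n) ι) (u : ι → Fin 2 × Fin 2 → k)
    (hA : ∀ i x, β.f i x = dotX (u i) x) (P P' Q Q' : Matrix (Fin 2) (Fin 2) k) (hP : P' * P = 1)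
    (hQ : Q * Q' = 1) : ∀ i x, (xSandwich β P P' Q Q' hP hQ).f i x = dotX (sand P Q (u i)) x := by
  intro i x
  rw [xSandwich, BilinComp.comap_f, LinearMap.comp_apply, mulRightLin_apply, mulLeftLin_apply, hA,
    ← Matrix.mul_assoc, dotX_sand]

end Sandwich

/-! ## At most five invertible X-forms at `r ≤ 3n + 1` over `𝔽₅` -/

section GF5

/-- A multiple-free variant of `okW5_of_eq_mul`. -/
theorem okW5_congr {A R : Fin 2 × Fin 2 → ZMod 5} (h : ∀ p, A p = R p) {w : ℕ} (hR : okW5 R w = true) :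
    okW5 A w = true :=
  okW5_of_eq_mul (s := 1) (fun p => by rw [h p, one_mul]) hR

/-- **Two distinct products never annihilate a common dual-type / `𝔽₂₅`-type plane** when `|ι| ≤ 3n + 1`. -/
theorem pair_false_gf5 {n : ℕ} {ι : Type*} [Fintype ι] [DecidableEq ι] (hι : Fintype.card ι ≤ 3 * n + 1)
    (β : BilinComp (mulBilin (ZMod 5) 2 2 n) ι) (u : ι → Fin 2 × Fin 2 → ZMod 5)
    (hA : ∀ i x, β.f i x = dotX (u i) x) {i i' : ι} (hii : i ≠ i') {w : ℕ}
    (hi : okW5 (u i) w = true) (hi' : okW5 (u i') w = true) : False := by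
  classical
  rcases common_of_okW5 hi hi' with ⟨l, h1, h2⟩ | ⟨l, h1, h2⟩
  · have h := (jPlane5 l).three_mul_add_card_le β u hA (fun t => perpJ5 (u t) l = true) (fun t ht => perpJ5_dotX ht)
    have h2' : 1 < (Finset.univ.filter fun t => perpJ5 (u t) l = true).card :=
      Finset.one_lt_card_iff.2 ⟨i, i', by simp [h1], by simp [h2], hii⟩
    omega
  · have h := (qPlane5 l).three_mul_add_card_le zmod5_sq_ne β u hA (fun t => perpQ5 (u t) l = true)
      (fun t ht => perpQ5_dotX ht)
    have h2' : 1 < (Finset.univ.filter fun t => perpQ5 (u t) l = true).card :=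
      Finset.one_lt_card_iff.2 ⟨i, i', by simp [h1], by simp [h2], hii⟩
    omega

/-- **No six products with invertible X-forms** when `|ι| ≤ 3n + 1` (clique number of "uncapped" is `5`). -/
theorem no_six_gf5 {n : ℕ} {ι : Type*} [Fintype ι] [DecidableEq ι] (hι : Fintype.card ι ≤ 3 * n + 1)
    (β : BilinComp (mulBilin (ZMod 5) 2 2 n) ι) (u : ι → Fin 2 × Fin 2 → ZMod 5)
    (hA : ∀ i x, β.f i x = dotX (u i) x) (t : Fin 6 → ι) (ht : Function.Injective t)
    (hinv : ∀ j, det2 (u (t j)) ≠ 0) : False := by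
  classical
  have hne : ∀ {j j' : Fin 6}, j ≠ j' → t j ≠ t j' := fun h e => h (ht e)
  -- first normalisation: the form of `t 0` becomes `I`
  have hdA : det2 (u (t 0)) ≠ 0 := hinv 0
  set β₁ := xSandwich β (P1 (u (t 0))) (P1' (u (t 0))) 1 1 (P1'_mul_P1 _ hdA) (Matrix.mul_one 1) with hβ₁
  set u₁ : ι → Fin 2 × Fin 2 → ZMod 5 := fun i => sand (P1 (u (t 0))) 1 (u i) with hu₁
  have hA₁ : ∀ i x, β₁.f i x = dotX (u₁ i) x := xSandwich_dotX β u hA _ _ _ _ _ _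
  have h10 : ∀ p, u₁ (t 0) p = idC5 p := sand_P1 _ hdA
  have hinv₁ : ∀ j, det2 (u₁ (t j)) ≠ 0 := by
    intro j
    show det2 (sand _ _ (u (t j))) ≠ 0
    rw [det2_sand, mdet2_one, mul_one]
    exact mul_ne_zero (mdet2_P1_ne_zero _ hdA) (hinv j)
  -- the class of the second form
  obtain ⟨_, hrep2⟩ := repF5_spec (u₁ (t 1)) (hinv₁ 1)
  have hval2 : det2 (repF5 (code5 (u₁ (t 1)))) ≠ 0 := by
    intro h0; apply hinv₁ 1; rw [det2_of_eq_mul hrep2, h0, mul_zero]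
  by_cases hI2 : wI5 (code5 (u₁ (t 1))) = 0
  swap
  · obtain ⟨w1, w2⟩ := wI5_ok _ hval2 hI2
    exact pair_false_gf5 hι β₁ u₁ hA₁ (hne (by decide)) (okW5_congr h10 w1) (okW5_of_eq_mul hrep2 w2)
  -- second normalisation: the form of `t 1` becomes a multiple of `D_β`
  obtain ⟨hPP, -, hid, hdiag, _⟩ := cj5_ok _ hval2 hI2
  set c₂ := code5 (u₁ (t 1)) with hc₂
  set b := cjB5 c₂ with hb
  set β₂ := xSandwich β₁ (cjP5 c₂) (cjPi5 c₂) (cjPi5 c₂) (cjP5 c₂) hPP hPP with hβ₂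
  set u₂ : ι → Fin 2 × Fin 2 → ZMod 5 := fun i => sand (cjP5 c₂) (cjPi5 c₂) (u₁ i) with hu₂
  have hA₂ : ∀ i x, β₂.f i x = dotX (u₂ i) x := xSandwich_dotX β₁ u₁ hA₁ _ _ _ _ _ _
  have h20 : ∀ p, u₂ (t 0) p = idC5 p := by
    intro p
    show sand _ _ (u₁ (t 0)) p = _
    rw [sand_congr h10]; exact hid p
  have h21 : ∀ p, u₂ (t 1) p = (lead5 (u₁ (t 1)) * cjS5 c₂) * D5 b p := by
    intro p
    show sand _ _ (u₁ (t 1)) p = _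
    rw [sand_smul hrep2 p, hdiag p, mul_assoc]
  have hinv₂ : ∀ j, det2 (u₂ (t j)) ≠ 0 := by
    intro j
    show det2 (sand _ _ (u₁ (t j))) ≠ 0
    rw [det2_sand]
    exact mul_ne_zero (mul_ne_zero (mdet2_ne_zero_right hPP) (hinv₁ j)) (mdet2_ne_zero_left hPP)
  -- the other four forms lie in listed classes
  have hmem : ∀ j : Fin 6, j ≠ 0 → j ≠ 1 →
      ∃ p : Fin 20, ∀ q, u₂ (t j) q = lead5 (u₂ (t j)) * repF5 (nb5 b p) q := by
    intro j hj0 hj1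
    obtain ⟨_, hrep⟩ := repF5_spec (u₂ (t j)) (hinv₂ j)
    have hval : det2 (repF5 (code5 (u₂ (t j)))) ≠ 0 := by
      intro h0; apply hinv₂ j; rw [det2_of_eq_mul hrep, h0, mul_zero]
    by_cases hI : wI5 (code5 (u₂ (t j))) = 0
    swap
    · obtain ⟨w1, w2⟩ := wI5_ok _ hval hI
      exact (pair_false_gf5 hι β₂ u₂ hA₂ (hne hj0.symm) (okW5_congr h20 w1) (okW5_of_eq_mul hrep w2)).elim
    by_cases hD : wD5 b (code5 (u₂ (t j))) = 0
    swap
    · obtain ⟨w1, w2⟩ := wD5_ok b _ hval hD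
      exact (pair_false_gf5 hι β₂ u₂ hA₂ (hne hj1.symm) (okW5_of_eq_mul h21 w1) (okW5_of_eq_mul hrep w2)).elim
    obtain ⟨p, hp⟩ := mem5_ok b _ hval hI hD
    exact ⟨p, fun q => by rw [hp]; exact hrep q⟩
  obtain ⟨p₂, hp₂⟩ := hmem 2 (by decide) (by decide)
  obtain ⟨p₃, hp₃⟩ := hmem 3 (by decide) (by decide)
  obtain ⟨p₄, hp₄⟩ := hmem 4 (by decide) (by decide)
  obtain ⟨p₅, hp₅⟩ := hmem 5 (by decide) (by decide)
  -- a capped pair among four listed classes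
  have hpair : ∀ {j j' : Fin 6} {p p' : Fin 20}, j ≠ j' →
      (∀ q, u₂ (t j) q = lead5 (u₂ (t j)) * repF5 (nb5 b p) q) →
      (∀ q, u₂ (t j') q = lead5 (u₂ (t j')) * repF5 (nb5 b p') q) → wN5 b p p' ≠ 0 → False := by
    intro j j' p p' hjj hj hj' hw
    obtain ⟨w1, w2⟩ := wN5_ok b p p' hw
    exact pair_false_gf5 hι β₂ u₂ hA₂ (hne hjj) (okW5_of_eq_mul hj w1) (okW5_of_eq_mul hj' w2)
  rcases four5_ok b p₂ p₃ with h | h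
  · exact hpair (by decide) hp₂ hp₃ h
  rcases h p₄ with (h | h) | h
  · exact hpair (by decide) hp₂ hp₄ h
  · exact hpair (by decide) hp₃ hp₄ h
  rcases h p₅ with h | h | h
  · exact hpair (by decide) hp₂ hp₅ h
  · exact hpair (by decide) hp₃ hp₅ h
  · exact hpair (by decide) hp₄ hp₅ h

/-! ## The counting -/

/-- **The counting at `r ≤ 3n + 1` over `𝔽₅`**: a decomposition of `⟨2,2,n⟩` over `𝔽₅` into `r ≤ 3n + 1` triads has
`r ≤ 17` (`6z + a ≤ 12` by the row planes, `b ≤ 5` by `no_six_gf5`). -/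
theorem card_le_seventeen_gf5 (n r : ℕ) (w : Fin r → Fin 2 × Fin n → ZMod 5)
    (u : Fin r → Fin 2 × Fin 2 → ZMod 5) (v : Fin r → Fin 2 × Fin n → ZMod 5)
    (hdec : matMulTensor (ZMod 5) 2 2 n = ∑ i, triad (w i) (u i) (v i)) (hr : r ≤ 3 * n + 1) : r ≤ 17 := by
  classical
  set β := bilinCompOfTriads (ZMod 5) w u v hdec with hβ
  have hA : ∀ i x, β.f i x = dotX (u i) x := fun i x => rfl
  -- (L) the quantitative cap of each of the 6 row planes, summed
  have hRow : ∀ o : Option (ZMod 5), (Finset.univ.filter fun t => p1rep o ᵥ* xMat (u t) = 0).card + 6 * n ≤ 2 * r := by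
    intro o
    have h := card_vanishing_le_two_mul_sub (n := n) (le_refl 2) β (p1rep_ne_zero o)
      (Finset.univ.filter fun t => p1rep o ᵥ* xMat (u t) = 0)
      (fun i hi z => by
        rw [Finset.mem_filter] at hi
        rw [hA, dotX_vecMulVec_eq, hi.2, zero_dotProduct])
    simpa only [Fintype.card_fin] using h
  have hRsum : ∑ o : Option (ZMod 5), ((Finset.univ.filter fun t => p1rep o ᵥ* xMat (u t) = 0).card + 6 * n)
      ≤ ∑ _o : Option (ZMod 5), 2 * r := Finset.sum_le_sum fun o _ => hRow o
  rw [Finset.sum_add_distrib] at hRsum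
  simp only [Finset.sum_const, Finset.card_univ, smul_eq_mul] at hRsum
  have hL : ∑ i, (Fintype.card (Option (ZMod 5)) * (if u i = 0 then 1 else 0)
      + (if (u i ≠ 0 ∧ u i (0, 0) * u i (1, 1) - u i (0, 1) * u i (1, 0) = 0) then 1 else 0))
      ≤ ∑ o : Option (ZMod 5), (Finset.univ.filter fun t => p1rep o ᵥ* xMat (u t) = 0).card := by
    calc _ ≤ ∑ i, (Finset.univ.filter fun o : Option (ZMod 5) => p1rep o ᵥ* xMat (u i) = 0).card := by
          refine Finset.sum_le_sum fun i _ => ?_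
          by_cases h0 : u i = 0
          · have hz : ∀ o : Option (ZMod 5), p1rep o ᵥ* xMat (u i) = 0 := by
              intro o; ext j; simp [h0, xMat, Matrix.vecMul, dotProduct]
            have e1 : (if u i = 0 then 1 else 0) = 1 := if_pos h0
            have e2 : (if (u i ≠ 0 ∧ u i (0, 0) * u i (1, 1) - u i (0, 1) * u i (1, 0) = 0) then 1 else 0) = 0 :=
              if_neg (fun h => h.1 h0)
            rw [e1, e2, mul_one, add_zero, Finset.filter_true_of_mem fun o _ => hz o, Finset.card_univ]
          · by_cases hd : u i (0, 0) * u i (1, 1) - u i (0, 1) * u i (1, 0) = 0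
            · simp only [h0, hd, if_false, mul_zero, zero_add, ne_eq, not_false_eq_true, true_and, if_true]
              exact one_le_card_rowVan (u i) hd
            · simp [h0, hd]
      _ = _ := by
          simp only [Finset.card_filter]
          exact Finset.sum_comm
  -- (b ≤ 5)
  set T2 := Finset.univ.filter (fun t : Fin r => u t (0, 0) * u t (1, 1) - u t (0, 1) * u t (1, 0) ≠ 0) with hT2
  have hT2le : T2.card ≤ 5 := by
    by_contra h5
    obtain ⟨S, hS, hScard⟩ := Finset.exists_subset_card_eq (show 6 ≤ T2.card by omega)
    have hcard : Fintype.card S = 6 := by rw [Fintype.card_coe, hScard]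
    let e : Fin 6 ≃ S := (Fintype.equivFinOfCardEq hcard).symm
    refine no_six_gf5 (ι := Fin r) (by simpa using hr) β u hA (fun j => ((e j : S) : Fin r)) ?_ ?_
    · intro j j' h
      exact e.injective (Subtype.ext h)
    · intro j
      have hm := hS (e j).2
      rw [hT2, Finset.mem_filter] at hm
      exact hm.2
  -- bookkeeping
  set Z0 := Finset.univ.filter (fun t : Fin r => u t = 0) with hZ0
  set R1 := Finset.univ.filter (fun t : Fin r => u t ≠ 0 ∧ u t (0, 0) * u t (1, 1) - u t (0, 1) * u t (1, 0) = 0) with hR1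
  have hpart : ∀ A : Fin 2 × Fin 2 → ZMod 5, (if A = 0 then 1 else 0)
      + (if (A ≠ 0 ∧ A (0, 0) * A (1, 1) - A (0, 1) * A (1, 0) = 0) then 1 else 0)
      + (if A (0, 0) * A (1, 1) - A (0, 1) * A (1, 0) ≠ 0 then 1 else 0) = 1 := by
    intro A
    by_cases h0 : A = 0
    · simp [h0]
    · by_cases hd : A (0, 0) * A (1, 1) - A (0, 1) * A (1, 0) = 0 <;> simp [h0, hd]
  have hpsum := Finset.sum_congr rfl fun i (_ : i ∈ (Finset.univ : Finset (Fin r))) => hpart (u i)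
  rw [Finset.sum_add_distrib, Finset.sum_add_distrib, Finset.sum_boole, Finset.sum_boole, Finset.sum_boole] at hpsum
  simp only [Finset.sum_const, Finset.card_univ, Fintype.card_fin, smul_eq_mul, mul_one, Nat.cast_id] at hpsum
  rw [Finset.sum_add_distrib, ← Finset.mul_sum, Finset.sum_boole, Finset.sum_boole] at hL
  simp only [Nat.cast_id] at hL
  rw [← hZ0, ← hR1, ← hT2] at hpsum
  rw [← hZ0, ← hR1] at hL
  have hO : Fintype.card (Option (ZMod 5)) = 6 := rfl
  rw [hO] at hL hRsum
  omega

/-- **`3n + 2 ≤ R_𝔽₅(⟨2,2,n⟩)` for every `n ≥ 6`** (unconditional kernel bound; the printed any-field bound is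
Alekseev 2014/2015, `n ≥ 3`). -/
theorem three_mul_add_two_le_tensorRank_matMulTensor_22n_gf5 (n : ℕ) (hn : 6 ≤ n) :
    3 * n + 2 ≤ tensorRank (matMulTensor (ZMod 5) 2 2 n) := by
  have h1 := three_mul_add_one_le_tensorRank_matMulTensor_22n (ZMod 5) n (by omega)
  by_contra hlt
  obtain ⟨w, u, v, hdec⟩ := exists_triad_decomposition_tensorRank (matMulTensor (ZMod 5) 2 2 n)
  have h17 := card_le_seventeen_gf5 n _ w u v hdec (by omega)
  omega

/-- The combined kernel floor over `𝔽₅`: `max(3n + 2, ⌈28n/9⌉) ≤ R_𝔽₅(⟨2,2,n⟩) ≤ ⌈7n/2⌉` for `n ≥ 6`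
(floor = the printed any-field / Alekseev–Nazarov values; ceiling = Hopcroft–Kerr gluing). -/
theorem tensorRank_matMulTensor_22n_gf5_window (n : ℕ) (hn : 6 ≤ n) :
    max (3 * n + 2) ((28 * n + 8) / 9) ≤ tensorRank (matMulTensor (ZMod 5) 2 2 n) ∧
      tensorRank (matMulTensor (ZMod 5) 2 2 n) ≤ (7 * n + 1) / 2 := by
  have h1 := three_mul_add_two_le_tensorRank_matMulTensor_22n_gf5 n hn
  have h2 := three_mul_sq_add_three_mul_le_tensorRank_matMulTensor_22n (ZMod 5) n
  have hq : Fintype.card (ZMod 5) = 5 := ZMod.card 5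
  rw [hq] at h2
  refine ⟨max_le h1 ?_, hopcroftKerr1971_tensorRank_matMulTensor_22n_le (K := ZMod 5) n⟩
  omega

/-- Census numerals over `𝔽₅` (the four cells this file adds): `20 ≤ R_𝔽₅(⟨2,2,6⟩) ≤ 21`, `23 ≤ R_𝔽₅(⟨2,2,7⟩) ≤ 25`,
`26 ≤ R_𝔽₅(⟨2,2,8⟩) ≤ 28`, `29 ≤ R_𝔽₅(⟨2,2,9⟩) ≤ 32`. -/
theorem tensorRank_matMulTensor_22n_gf5_numerals :
    tensorRank (matMulTensor (ZMod 5) 2 2 6) ∈ Set.Icc 20 21 ∧ tensorRank (matMulTensor (ZMod 5) 2 2 7) ∈ Set.Icc 23 25 ∧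
      tensorRank (matMulTensor (ZMod 5) 2 2 8) ∈ Set.Icc 26 28 ∧ tensorRank (matMulTensor (ZMod 5) 2 2 9) ∈ Set.Icc 29 32 := by
  refine ⟨⟨?_, ?_⟩, ⟨?_, ?_⟩, ⟨?_, ?_⟩, ⟨?_, ?_⟩⟩
  · exact three_mul_add_two_le_tensorRank_matMulTensor_22n_gf5 6 (by norm_num)
  · exact hopcroftKerr1971_tensorRank_matMulTensor_22n_le (K := ZMod 5) 6
  · exact three_mul_add_two_le_tensorRank_matMulTensor_22n_gf5 7 (by norm_num)
  · exact hopcroftKerr1971_tensorRank_matMulTensor_22n_le (K := ZMod 5) 7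
  · exact three_mul_add_two_le_tensorRank_matMulTensor_22n_gf5 8 (by norm_num)
  · exact hopcroftKerr1971_tensorRank_matMulTensor_22n_le (K := ZMod 5) 8
  · exact three_mul_add_two_le_tensorRank_matMulTensor_22n_gf5 9 (by norm_num)
  · exact hopcroftKerr1971_tensorRank_matMulTensor_22n_le (K := ZMod 5) 9

/-- The `⟨2,2,n⟩ / ⟨2,n,2⟩ / ⟨n,2,2⟩` orientations over `𝔽₅`: `3n + 2 ≤ R` for `n ≥ 6` in all three. -/
theorem three_mul_add_two_le_tensorRank_matMulTensor_2n2_n22_gf5 (n : ℕ) (hn : 6 ≤ n) :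
    3 * n + 2 ≤ tensorRank (matMulTensor (ZMod 5) 2 n 2) ∧ 3 * n + 2 ≤ tensorRank (matMulTensor (ZMod 5) n 2 2) := by
  constructor
  · rw [(Blaser2013_lemma55 (ZMod 5) 2 n 2).1]; exact three_mul_add_two_le_tensorRank_matMulTensor_22n_gf5 n hn
  · rw [(Blaser2013_lemma55 (ZMod 5) n 2 2).2.1]; exact three_mul_add_two_le_tensorRank_matMulTensor_22n_gf5 n hn

end GF5

end Summit.MatrixMultiplication.OmegaCensus.SmallFormats
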